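import Literature.MathematicalPhysics.QuantumFieldTheory.BalabanImbrieJaffe1984to88.BIJ88Vj5610Operator
import Literature.MathematicalPhysics.QuantumFieldTheory.BalabanImbrieJaffe1984to88.BIJ88RotationResidual282

/-!
# `BalabanImbrieJaffe1984to88.BIJ88Insertions288` — T. Bałaban, J. Imbrie, A. Jaffe, *Effective action and cluster properties of the abelian
Higgs model*, Commun. Math. Phys. **114** (1988) 257–315 [BalabanImbrieJaffe1988], Sect. 5.6 pp. 287–288 [PDF 31–32]: the three INSERTION
sentences around (5.6.8)–(5.6.12) as identities and a bound — p. 287, verbatim: *"Inserting this formula into |(ψ − Q(ũ_{k+1}ũ)φ)(y)|², we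
obtain the vertices new to this step."*; p. 288, verbatim: *"These expansions are inserted in F_{k,loc}, ⟨ψ − Q(u_k)φ, ψ − Q(u_k)φ⟩, 𝒫_{k,loc},
and in Δ_{k,loc}(ũ_{k+1}ũ) = a_kI − a_k²Q_k(ũ_{k+1}ũ)G_{k,loc}(ũ_{k+1}ũ)Q*_k(ũ_{k+1}ũ). We expand the phase factors as 1 + (e^{ie_kw₂A′} − 1), the
second term being extremely small."* (companion of this seat's `BIJ88Vj5610Operator` p311248, `BIJ88Eq5612W6`, `BIJ88VjSmall287`).

statement-level skeleton of published theorems with citation tags; proofs where landed; nothing here is a claim about the Yang–Mills mass gap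

PDF held: `paper:balaban1988-cmp114-bij-abelian-higgs-effective-action` (journal page = PDF page + 256); pp. 287–288 [PDF 31–32] read as
images this session (seat folder `pages/original-p031-x2.png`, `original-p032-x2.png`).

CITATION HEADER (lean-in-tree rule).  Part of the lit-balaban TYPED SKELETON (HOME `run/shared/lean/pub/lit-balaban/`), PHASE-2 proof seat
p31 gen 10 (unit `lit-balaban-p31-g10`; fourth file of the 2026-08-22T00:11Z TAKING).  WHAT IS REPRODUCED: row `C2.Eq5.6.6-5.6.12` of
`HOME/lit-balaban-r16/ROWS-C2-part2.md` (owner r16; v2.46 cell: *"the neighbouring sentences (insertion into F_{k,loc}/𝒫_{k,loc}/Δ_{k,loc}, the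
phase factors e^{ie_kw₂A′} «extremely small» = the (5.4.7) smallness of row C2.Eq5.4.7) not typed"*), the sentences quoted above.

THE MECHANISM.  (i) With (5.6.8) `Q(ũ_{k+1}ũ) = Q(ũ_{k+1}) + F₂` (this seat's `eq568_matrix`; r16's pointwise `eq568`) the square
`|(ψ − Q(ũ_{k+1}ũ)φ)(y)|²` is `|(ψ − Q(ũ_{k+1})φ)(y)|² − 2Re[conj((ψ − Q(ũ_{k+1})φ)(y))·(F₂φ)(y)] + |(F₂φ)(y)|²` — the last two terms are *"the
vertices new to this step"* (`normSq_vertex_expand`, `normSq_sub_covAvg_expand`).  (ii) `Δ_{k,loc}(u) = a_kI − a_k²Q_k(u)G_{k,loc}(u)Q*_k(u)`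
((2.34) = r18's `deltaLoc` = r15's `deltaScalar`) with `Q_k(ũ_{k+1}ũ) = Q + F`, `Q*_k(ũ_{k+1}ũ) = Q* + F*` and `G_{k,loc}(ũ_{k+1}ũ) = G′` inserted:
`Δ_{k,loc}(ũ_{k+1}ũ) = Δ_{k,loc}(ũ_{k+1}) − a_k²[FG′(Q* + F*) + QG′F* + Q(G′ − G)Q*]` (`deltaLoc_insert` in any `ℝ`-algebra; `delta_insert_matrix`
for the rectangular block-average matrices with `Q* = Qᴴ`, where `G′ − G` is the expansion (5.6.12) of `BIJ88Eq5612W6`).  (iii) The phase factor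
`e^{ie_k(w₂A′)(x)} = 1 + F₁(ie_k(w₂A′)(x))` (`phase_expand`, r16's `one_add_F1`) with `‖F₁(w)‖ ≦ 2‖w‖` (r16's `norm_F1_le`) and the (5.4.7) shape
`|w₂(x,b)| ≦ e^{−cr(e_k)}e^{−c dist(x,b)}` (r16's typed `Ineq547`, row C2.Eq5.4.7; r16 g8's `abs_sum_mul_le_of_ineq547`: `|(w₂A′)(x)| ≦ e^{−cr(e_k)}Sa`
for `|A′| ≦ a` and the lattice sum `Σ_be^{−c dist(x,b)} ≦ S`): `‖e^{ie_k(w₂A′)(x)} − 1‖ ≦ 2e_k·e^{−cr(e_k)}·S·a` — *"extremely small"*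
(`norm_phase_sub_one_le`).

WHAT IS PROVED (0 `sorry`, standard axioms; theorems only, no definitions, no `Prop` facts).
* §1 `normSq_vertex_expand` (the complex identity), **`normSq_sub_covAvg_expand`** (for r16's `covAvg`/`F2` with the perturbed transporters
  `U·e^{A}`), `normSq_sub_qMat_expand` (matrix form).
* §2 **`deltaLoc_insert`** (ring level, r18's `deltaLoc`), **`delta_insert_matrix`** (rectangular matrices, `Q* = Qᴴ`, with (5.6.8) inserted:
  `Q(Ue^A) = Q(U) + F₂`).
* §3 `phase_expand`, **`norm_phase_sub_one_le`**, `norm_phase_sub_one_le_of_rowSum`.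
HONEST SCOPE.  Identities and one bound; the insertion into `F_{k,loc}` and `𝒫_{k,loc}` (generic functionals of the fields) has no displayed
form in print and is not typed; (5.4.7) enters as r16's typed shape `Ineq547` (a printed claim on its own row, proved there for `w₂` on the tori
by p02/p36), the lattice-sum constant `S` and `|A′| ≦ a = cp(e_k)` ((5.3.1)) as displayed hypotheses.  Unit `lit-balaban-p31` (literature-
prover-lit-balaban-p31-g10-0), 2026-08-22.  NOT summit progress.
-/

namespace Literature.MathematicalPhysics.QuantumFieldTheory.BalabanImbrieJaffe1984to88.BIJ88Insertions288

open Literature.MathematicalPhysics.QuantumFieldTheory.Balaban1983to89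
open BIJ88Sect2Statements (deltaLoc)
open BIJ88Sect5Statements (F1 one_add_F1 norm_F1_le)
open BIJ88Sect5StatementsPart2 (Ineq547)
open BIJ88Sect5StatementsPart4 (covAvg F2 eq568)
open BIJ88Vj5610Operator (qMat f2Mat qMat_mulVec f2Mat_mulVec eq568_matrix)
open BIJ88RotationResidual282 (abs_sum_mul_le_of_ineq547 abs_sum_mul_le_of_rowSum)
open scoped BigOperators Matrix ComplexConjugate
open Complex Matrix

noncomputable section

/-! ## §1 «Inserting this formula into |(ψ − Q(ũ_{k+1}ũ)φ)(y)|², we obtain the vertices new to this step» -/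

/-- kernel: `|a − (q + f)|² = |a − q|² − 2Re[conj(a − q)·f] + |f|²` — the square of the scalar term with the block average split as in (5.6.8);
the last two terms are the new vertices. [cite: BalabanImbrieJaffe1988, (5.6.8) p.287] -/
theorem normSq_vertex_expand (a q f : ℂ) :
    Complex.normSq (a - (q + f)) = Complex.normSq (a - q) - 2 * (conj (a - q) * f).re + Complex.normSq f := by
  rw [show a - (q + f) = (a - q) - f by ring, Complex.normSq_sub]
  have : (conj (a - q) * f).re = ((a - q) * conj f).re := by
    rw [← Complex.conj_re ((a - q) * conj f), map_mul, Complex.conj_conj, mul_comm]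
  rw [this]
  ring

/-- **p. 287 after (5.6.8)**, verbatim: *"Inserting this formula into |(ψ − Q(ũ_{k+1}ũ)φ)(y)|², we obtain the vertices new to this step."* — with
the perturbed transporters `ũ_{k+1}(Γ_{y,x})e^{A(y,x)}` (r16's `covAvg`, (5.6.8) `eq568`):
`|ψ(y) − (Q(ũ_{k+1}ũ)φ)(y)|² = |ψ(y) − (Q(ũ_{k+1})φ)(y)|² − 2Re[conj(ψ(y) − (Q(ũ_{k+1})φ)(y))·(F₂φ)(y)] + |(F₂φ)(y)|²`.
[cite: BalabanImbrieJaffe1988, (5.6.8) p.287] -/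
theorem normSq_sub_covAvg_expand {α β : Type*} (B : β → Finset α) (w : ℝ) (U A : β → α → ℂ) (φ : α → ℂ) (ψ : β → ℂ) (y : β) :
    Complex.normSq (ψ y - covAvg B w (fun y x => U y x * exp (A y x)) φ y)
      = Complex.normSq (ψ y - covAvg B w U φ y) - 2 * (conj (ψ y - covAvg B w U φ y) * F2 B w U A φ y).re
        + Complex.normSq (F2 B w U A φ y) := by
  rw [eq568, normSq_vertex_expand]

/-- kernel: the same with the block average as this seat's matrix `qMat` and the new vertices carried by `f2Mat`.
[cite: BalabanImbrieJaffe1988, (5.6.8) p.287] -/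
theorem normSq_sub_qMat_expand {α β : Type*} [Fintype α] [DecidableEq α] (B : β → Finset α) (w : ℝ) (U A : β → α → ℂ) (φ : α → ℂ)
    (ψ : β → ℂ) (y : β) :
    Complex.normSq (ψ y - (qMat B w (fun y x => U y x * exp (A y x)) *ᵥ φ) y)
      = Complex.normSq (ψ y - (qMat B w U *ᵥ φ) y) - 2 * (conj (ψ y - (qMat B w U *ᵥ φ) y) * (f2Mat B w U A *ᵥ φ) y).re
        + Complex.normSq ((f2Mat B w U A *ᵥ φ) y) := by
  rw [eq568_matrix, add_mulVec, Pi.add_apply, normSq_vertex_expand]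

/-! ## §2 «These expansions are inserted in … Δ_{k,loc}(ũ_{k+1}ũ) = a_kI − a_k²Q_k(ũ_{k+1}ũ)G_{k,loc}(ũ_{k+1}ũ)Q*_k(ũ_{k+1}ũ)» -/

section Ring

variable {R : Type*} [Ring R] [Algebra ℝ R]

/-- **p. 288**, verbatim: *"These expansions are inserted in … Δ_{k,loc}(ũ_{k+1}ũ) = a_kI − a_k²Q_k(ũ_{k+1}ũ)G_{k,loc}(ũ_{k+1}ũ)Q*_k(ũ_{k+1}ũ)."* —
with `Q_k(ũ_{k+1}ũ) = Q + F` ((5.6.8)), `Q*_k(ũ_{k+1}ũ) = Q* + F*` and `G_{k,loc}(ũ_{k+1}ũ) = G′` ((5.6.12)) in r18's (2.34) `deltaLoc` (= r15's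
(I.4.6.4) `deltaScalar`, any `ℝ`-algebra of operators):
`Δ_{k,loc}(ũ_{k+1}ũ) = Δ_{k,loc}(ũ_{k+1}) − a_k²[FG′(Q* + F*) + QG′F* + Q(G′ − G)Q*]`. [cite: BalabanImbrieJaffe1988, (2.34) p.263] -/
theorem deltaLoc_insert (ak : ℝ) (Q F G G' Qs Fs : R) :
    deltaLoc ak (Q + F) G' (Qs + Fs)
      = deltaLoc ak Q G Qs - algebraMap ℝ R (ak ^ 2) * (F * G' * (Qs + Fs) + Q * G' * Fs + Q * (G' - G) * Qs) := by
  simp only [deltaLoc, BIJ85Sect4Statements.deltaScalar]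
  noncomm_ring

end Ring

/-- **the same for the rectangular block-average matrices** (`Q : Matrix τ σ ℂ` fine → unit lattice, `Q* = Qᴴ`, `G, G′ : Matrix σ σ ℂ`): with
(5.6.8) inserted, `Q(Ue^A) = Q(U) + F₂` (`BIJ88Vj5610Operator.eq568_matrix`),
`a·1 − a²·Q(Ue^A)G′Q(Ue^A)ᴴ = [a·1 − a²·Q(U)GQ(U)ᴴ] − a²·[F₂G′(Q + F₂)ᴴ + QG′F₂ᴴ + Q(G′ − G)Qᴴ]`. [cite: BalabanImbrieJaffe1988, (2.34) p.263] -/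
theorem delta_insert_matrix {σ τ : Type*} [Fintype σ] [DecidableEq σ] [Fintype τ] [DecidableEq τ] (a : ℝ) (B : τ → Finset σ) (w : ℝ)
    (U A : τ → σ → ℂ) (G G' : Matrix σ σ ℂ) :
    (a : ℂ) • (1 : Matrix τ τ ℂ) - ((a : ℂ) ^ 2) • (qMat B w (fun y x => U y x * exp (A y x)) * G' *
        (qMat B w (fun y x => U y x * exp (A y x)))ᴴ)
      = ((a : ℂ) • (1 : Matrix τ τ ℂ) - ((a : ℂ) ^ 2) • (qMat B w U * G * (qMat B w U)ᴴ))
        - ((a : ℂ) ^ 2) • (f2Mat B w U A * G' * (qMat B w U + f2Mat B w U A)ᴴ + qMat B w U * G' * (f2Mat B w U A)ᴴ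
          + qMat B w U * (G' - G) * (qMat B w U)ᴴ) := by
  rw [eq568_matrix, conjTranspose_add]
  have key : (qMat B w U + f2Mat B w U A) * G' * ((qMat B w U)ᴴ + (f2Mat B w U A)ᴴ)
      = qMat B w U * G * (qMat B w U)ᴴ + (f2Mat B w U A * G' * ((qMat B w U)ᴴ + (f2Mat B w U A)ᴴ)
        + qMat B w U * G' * (f2Mat B w U A)ᴴ + qMat B w U * (G' - G) * (qMat B w U)ᴴ) := by
    simp only [Matrix.add_mul, Matrix.mul_add, Matrix.mul_sub, Matrix.sub_mul]
    abel
  rw [key, smul_add]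
  abel

/-! ## §3 «We expand the phase factors as 1 + (e^{ie_kw₂A′} − 1), the second term being extremely small» -/

/-- **p. 288**, verbatim: *"We expand the phase factors as 1 + (e^{ie_kw₂A′} − 1)"* — `e^{ie_k(w₂A′)(x)} = 1 + F₁(ie_k(w₂A′)(x))` (r16's `F₁ = exp − 1`).
[cite: BalabanImbrieJaffe1988, (5.4.7) p.288] -/
theorem phase_expand {X B : Type} [Fintype B] (ek : ℝ) (w₂ : X → B → ℝ) (A' : B → ℝ) (x : X) :
    exp (I * ((ek * ∑ b, w₂ x b * A' b : ℝ) : ℂ)) = 1 + F1 (I * ((ek * ∑ b, w₂ x b * A' b : ℝ) : ℂ)) :=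
  (one_add_F1 _).symm

/-- kernel: *"the second term being extremely small"* from a ROW SUM: `Σ_b|w₂(x,b)| ≦ W`, `|A′| ≦ a`, `e_kWa ≦ 1` ⟹
`‖e^{ie_k(w₂A′)(x)} − 1‖ ≦ 2e_k·W·a`. [cite: BalabanImbrieJaffe1988, (5.4.7) p.288] -/
theorem norm_phase_sub_one_le_of_rowSum {X B : Type} [Fintype B] {ek W a : ℝ} (hek : 0 ≤ ek) (w₂ : X → B → ℝ) (A' : B → ℝ) {x : X}
    (hW : ∑ b, |w₂ x b| ≤ W) (hA : ∀ b, |A' b| ≤ a) (ha : 0 ≤ a) (hsmall : ek * W * a ≤ 1) :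
    ‖exp (I * ((ek * ∑ b, w₂ x b * A' b : ℝ) : ℂ)) - 1‖ ≤ 2 * ek * W * a := by
  have h1 : |∑ b, w₂ x b * A' b| ≤ W * a := abs_sum_mul_le_of_rowSum w₂ A' hW hA ha
  have h2 : ‖I * ((ek * ∑ b, w₂ x b * A' b : ℝ) : ℂ)‖ ≤ ek * W * a := by
    rw [norm_mul, Complex.norm_I, one_mul, Complex.norm_real, Real.norm_eq_abs, abs_mul, abs_of_nonneg hek, mul_assoc]
    exact mul_le_mul_of_nonneg_left h1 hek
  have h3 := norm_F1_le (h2.trans hsmall)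
  rw [F1] at h3
  linarith

/-- **p. 288**, verbatim: *"… the second term being extremely small."* — from the (5.4.7) shape for `w₂` (r16's typed `Ineq547`, row C2.Eq5.4.7:
`|w₂(x,b)| ≦ e^{−cr(e_k)}e^{−c dist(x,b)}`), the lattice sum `Σ_be^{−c dist(x,b)} ≦ S` and `|A′| ≦ a` ((5.3.1): `a = cp(e_k)`), in the regime
`e_ke^{−cr(e_k)}Sa ≦ 1`: `‖e^{ie_k(w₂A′)(x)} − 1‖ ≦ 2e_k·e^{−cr(e_k)}·S·a`. [cite: BalabanImbrieJaffe1988, (5.4.7) p.288] -/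
theorem norm_phase_sub_one_le {X B : Type} [Fintype B] {ek c rk S a : ℝ} (hek : 0 ≤ ek) (w₂ : X → B → ℝ) (dist : X → B → ℝ)
    (A' : B → ℝ) (h547 : Ineq547 X B w₂ dist c rk) {x : X} (hS : ∑ b, Real.exp (-(c * dist x b)) ≤ S) (hA : ∀ b, |A' b| ≤ a)
    (ha : 0 ≤ a) (hsmall : ek * (Real.exp (-(c * rk)) * S) * a ≤ 1) :
    ‖exp (I * ((ek * ∑ b, w₂ x b * A' b : ℝ) : ℂ)) - 1‖ ≤ 2 * ek * (Real.exp (-(c * rk)) * S) * a := by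
  have h1 : |∑ b, w₂ x b * A' b| ≤ Real.exp (-(c * rk)) * S * a := abs_sum_mul_le_of_ineq547 w₂ dist A' h547 hS hA ha
  have h2 : ‖I * ((ek * ∑ b, w₂ x b * A' b : ℝ) : ℂ)‖ ≤ ek * (Real.exp (-(c * rk)) * S) * a := by
    rw [norm_mul, Complex.norm_I, one_mul, Complex.norm_real, Real.norm_eq_abs, abs_mul, abs_of_nonneg hek, mul_assoc]
    exact mul_le_mul_of_nonneg_left h1 hek
  have h3 := norm_F1_le (h2.trans hsmall)
  rw [F1] at h3
  linarith

end

end Literature.MathematicalPhysics.QuantumFieldTheory.BalabanImbrieJaffe1984to88.BIJ88Insertions288
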